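import Summits.Ventures.PercRepro2.CaseOnePairPocketB
import Summits.Ventures.PercRepro2.CaseOneMarkMoves
import Summits.Ventures.PercRepro2.CaseOneMarkCoincidences

/-!
# Two special vertices in a common pocket at ANY cut vertex are closed
(blind cell PercRepro2, p1 g29; the pair reduction of p1 g27 closed without any condition on the cut
vertex, by the mark moves)

`closedAt_of_pair` (CaseOnePairPocketMain) turns a mark-free-otherwise pocket holding two of
`a₃, o, b` into the tree gadget `x ~ w ~ {z₁, z₂}`, in which `z₁` and `z₂` are leaves at the hub `w`
(`IsPairPocket.isLeafAt_hub`, **`IsPairPocket.isLeafAt_z₂`**). A pendant statement vertex moves to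
the hub (`MoveStep.leafMove`); a pendant mark `o` or `b` is replaced by the hub (the MARK MOVES
`closedAt_of_o_move` / `closedAt_of_b_move`, CaseOneMarkMoves); after the moves the special vertices
coincide at `w`, a closed marking (`MarkAnchor` when the statement vertex is a mark,
`closedAt_of_o_eq_b` when the two marks coincide). No hypothesis on the cut vertex `x` remains:
**`closedAt_of_pair_any`** — a statement vertex and `o` (or `b`) in a common mark-free-otherwise pocket
hanging at ANY vertex are closed (`closedAt_of_pair_at_root` (g27), `closedAt_of_pair_at_root_b` (g28)
and `closedAt_of_pair_at_mark` (g29) are its special cases) — and **`closedAt_of_ob_pocket`** — the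
marks `o` and `b` in a common mark-free-otherwise pocket hanging at any vertex close every statement
vertex outside it. Also **`closedAt_of_o_pocket_at_a3`** / **`closedAt_of_b_pocket_at_a3`**: a mark
alone in a mark-free-otherwise pocket hanging at the statement vertex closes it (the pocket is a
pendant mark at `a₃`, which moves onto `a₃`); **`closedAt_of_o_b_leaves`**: `o` and `b` pendant at a
common vertex close every statement vertex. Own code; standard axioms.
-/

namespace Summit.Ventures.PercRepro2

namespace CaseOne

universe u

section LeafZ
variable {V : Type*} {E : Type u} [DecidableEq E]
variable {ends : E → Sym2 V} {W : Set V} {x : V} {P : Finset E} {e₁ e₂ e₃ : E} {w z₁ z₂ : V}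

/-- **In the gadget minus the leaf edge, `z₂` is a leaf at the hub** through `e₃`. -/
lemma IsPairPocket.isLeafAt_z₂ (hh : IsPairPocket ends W x P e₁ e₂ e₃ w z₁ z₂) :
    IsLeafAt (restrictEnds (pairEnds ends P e₁ e₂ e₃ x w z₁ z₂) e₂) w z₂ ⟨e₃, hh.ne₂₃.symm⟩ where
  ends_eq := by
    simp only [restrictEnds]
    exact pairEnds_e₃ hh.ne₁₃ hh.ne₂₃
  unique := by
    intro e hmem
    simp only [restrictEnds] at hmem
    by_cases he1 : e.1 = e₁
    · rw [he1, pairEnds_e₁, Sym2.mem_iff] at hmem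
      rcases hmem with h | h
      · exact absurd (h ▸ hh.mem_z₂) hh.pocket.x_not_mem
      · exact absurd h.symm hh.hub_ne₂
    by_cases he3 : e.1 = e₃
    · exact Subtype.ext he3
    by_cases heP : e.1 ∈ P
    · rw [pairEnds_of_mem heP he1 e.2 he3, Sym2.mem_iff] at hmem
      rcases hmem with h | h <;> exact absurd (h ▸ hh.mem_z₂) hh.pocket.x_not_mem
    · rw [pairEnds_of_not_mem heP hh.mem₁ hh.mem₂ hh.mem₃] at hmem
      exact absurd (hh.pocket.mem_P hh.mem_z₂ hmem) heP
  ne := hh.hub_ne₂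

end LeafZ

section PairAny
variable {V : Type*} [Fintype V] [DecidableEq V] {R : Type*} [Field R] [LinearOrder R]
  [IsStrictOrderedRing R] {E : Type u} [Fintype E] [DecidableEq E]
variable {ends : E → Sym2 V} {W : Set V} {x : V} {P : Finset E} {e₁ e₂ e₃ : E} {w : V}
  {o a₁ a₂ a₃ b : V}

/-- **A statement vertex and the mark `o` in a common mark-free-otherwise pocket hanging at ANY
vertex are closed** (`a₁, a₂, b` outside the pocket). -/
theorem closedAt_of_pair_any_o (hh : IsPairPocket ends W x P e₁ e₂ e₃ w a₃ o) (h1 : a₁ ∉ W)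
    (h2 : a₂ ∉ W) (hb : b ∉ W) : ClosedAt R o a₁ a₂ b E ends a₃ := by
  refine closedAt_of_pair hh h1 h2 (Or.inr (Or.inr rfl)) (Or.inr (Or.inl rfl)) (Or.inl hb) ?_
  -- the pendant step `a₃ → w`
  have hmove : Moves o a₁ a₂ b {e : E // e ≠ e₂}
      (restrictEnds (pairEnds ends P e₁ e₂ e₃ x w a₃ o) e₂) w E
      (pairEnds ends P e₁ e₂ e₃ x w a₃ o) a₃ :=
    Moves.tail (Moves.refl _ _ _)
      (MoveStep.leafMove E (pairEnds ends P e₁ e₂ e₃ x w a₃ o) w a₃ e₂ hh.isLeafAt_hub hh.ne_z.symm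
        (fun h => h1 (h ▸ hh.mem_z₁)) (fun h => h2 (h ▸ hh.mem_z₁)) (fun h => hb (h ▸ hh.mem_z₁)))
  refine closedAt_of_moves hmove ?_
  -- the mark move `o → w`: the statement vertex becomes the mark
  refine closedAt_of_o_move hh.isLeafAt_z₂ (fun h => h1 (h ▸ hh.mem_z₂))
    (fun h => h2 (h ▸ hh.mem_z₂)) hh.hub_ne₂ (fun h => hb (h ▸ hh.mem_z₂)) ?_
  exact closedAt_of_closedAnchor w a₁ a₂ b _ _ w (Or.inl (Or.inl rfl))

/-- **A statement vertex and the mark `b` in a common mark-free-otherwise pocket hanging at ANY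
vertex are closed** (`o, a₁, a₂` outside the pocket). -/
theorem closedAt_of_pair_any_b (hh : IsPairPocket ends W x P e₁ e₂ e₃ w a₃ b) (ho : o ∉ W)
    (h1 : a₁ ∉ W) (h2 : a₂ ∉ W) : ClosedAt R o a₁ a₂ b E ends a₃ := by
  refine closedAt_of_pair hh h1 h2 (Or.inl ho) (Or.inr (Or.inl rfl)) (Or.inr (Or.inr rfl)) ?_
  have hmove : Moves o a₁ a₂ b {e : E // e ≠ e₂}
      (restrictEnds (pairEnds ends P e₁ e₂ e₃ x w a₃ b) e₂) w E
      (pairEnds ends P e₁ e₂ e₃ x w a₃ b) a₃ :=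
    Moves.tail (Moves.refl _ _ _)
      (MoveStep.leafMove E (pairEnds ends P e₁ e₂ e₃ x w a₃ b) w a₃ e₂ hh.isLeafAt_hub
        (fun h => ho (h ▸ hh.mem_z₁)) (fun h => h1 (h ▸ hh.mem_z₁)) (fun h => h2 (h ▸ hh.mem_z₁))
        hh.ne_z.symm)
  refine closedAt_of_moves hmove ?_
  refine closedAt_of_b_move hh.isLeafAt_z₂ (fun h => ho (h ▸ hh.mem_z₂))
    (fun h => h1 (h ▸ hh.mem_z₂)) (fun h => h2 (h ▸ hh.mem_z₂)) hh.hub_ne₂ ?_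
  exact closedAt_of_closedAnchor o a₁ a₂ w _ _ w (Or.inl (Or.inr (Or.inr (Or.inr rfl))))

/-- **The pair reduction closed**: a statement vertex and a mark `z ∈ {o, b}` in a common
mark-free-otherwise pocket hanging at any vertex are closed (`o ≠ b`; the other marks outside). -/
theorem closedAt_of_pair_any {z : V} (hh : IsPairPocket ends W x P e₁ e₂ e₃ w a₃ z)
    (hz : z = o ∨ z = b) (hob : o ≠ b) (h1 : a₁ ∉ W) (h2 : a₂ ∉ W) (ho : o ∉ W ∨ o = z)
    (hb : b ∉ W ∨ b = z) : ClosedAt R o a₁ a₂ b E ends a₃ := by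
  rcases hz with rfl | rfl
  · exact closedAt_of_pair_any_o hh h1 h2 (hb.elim id fun h => absurd h.symm hob)
  · exact closedAt_of_pair_any_b hh (ho.elim id fun h => absurd h hob) h1 h2

/-- `(J1₁)` at a statement vertex sharing a mark-free-otherwise pocket with `o` or `b`. -/
theorem jOneOne_of_pair_any {z : V} (hh : IsPairPocket ends W x P e₁ e₂ e₃ w a₃ z)
    (hz : z = o ∨ z = b) (hob : o ≠ b) (h1 : a₁ ∉ W) (h2 : a₂ ∉ W) (ho : o ∉ W ∨ o = z)
    (hb : b ∉ W ∨ b = z) (p : E → R) (hp : IsProbVec p) : JOneOne p ends o a₁ a₂ a₃ b :=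
  jOneOne_of_i_of_ii p ends o a₁ a₂ a₃ b (closedAt_of_pair_any hh hz hob h1 h2 ho hb p hp).2.2.1
    (closedAt_of_pair_any hh hz hob h1 h2 ho hb p hp).1

/-- **The marks `o` and `b` in a common mark-free-otherwise pocket hanging at ANY vertex close every
statement vertex outside it**: both marks move to the hub and coincide there. -/
theorem closedAt_of_ob_pocket (hh : IsPairPocket ends W x P e₁ e₂ e₃ w o b) (h1 : a₁ ∉ W)
    (h2 : a₂ ∉ W) (ha : a₃ ∉ W) : ClosedAt R o a₁ a₂ b E ends a₃ := by
  refine closedAt_of_pair hh h1 h2 (Or.inr (Or.inl rfl)) (Or.inl ha) (Or.inr (Or.inr rfl)) ?_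
  -- the mark move `o → w`
  refine closedAt_of_o_move hh.isLeafAt_hub (fun h => h1 (h ▸ hh.mem_z₁))
    (fun h => h2 (h ▸ hh.mem_z₁)) (fun h => ha (h ▸ hh.mem_z₁)) hh.ne_z.symm ?_
  -- the mark move `b → w`
  refine closedAt_of_b_move hh.isLeafAt_z₂ hh.hub_ne₂ (fun h => h1 (h ▸ hh.mem_z₂))
    (fun h => h2 (h ▸ hh.mem_z₂)) (fun h => ha (h ▸ hh.mem_z₂)) ?_
  -- `o = b = w`
  exact closedAt_of_o_eq_b a₁ a₂ a₃ w

end PairAny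

section PocketAtA3
variable {V : Type*} [Fintype V] [DecidableEq V] {R : Type*} [Field R] [LinearOrder R]
  [IsStrictOrderedRing R] {E : Type u} [Fintype E] [DecidableEq E]
variable {ends : E → Sym2 V} {W : Set V} {P : Finset E} {e₀ : E} {o a₁ a₂ a₃ b : V}

/-- **The mark `o` alone in a mark-free-otherwise pocket hanging at the statement vertex closes it**:
the pocket is a pendant `o` at `a₃`, which moves onto `a₃`. -/
theorem closedAt_of_o_pocket_at_a3 (h : IsPocket ends W a₃ P) (he : e₀ ∈ P) (ho : o ∈ W)
    (h1 : a₁ ∉ W) (h2 : a₂ ∉ W) (hb : b ∉ W) : ClosedAt R o a₁ a₂ b E ends a₃ :=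
  closedAt_of_o_pocket_move h he ho h1 h2 h.x_not_mem hb
    (closedAt_of_closedAnchor a₃ a₁ a₂ b _ _ a₃ (Or.inl (Or.inl rfl)))

/-- **The mark `b` alone in a mark-free-otherwise pocket hanging at the statement vertex closes it.** -/
theorem closedAt_of_b_pocket_at_a3 (h : IsPocket ends W a₃ P) (he : e₀ ∈ P) (hb : b ∈ W)
    (ho : o ∉ W) (h1 : a₁ ∉ W) (h2 : a₂ ∉ W) : ClosedAt R o a₁ a₂ b E ends a₃ :=
  closedAt_of_b_pocket_move h he hb ho h1 h2 h.x_not_mem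
    (closedAt_of_closedAnchor o a₁ a₂ a₃ _ _ a₃ (Or.inl (Or.inr (Or.inr (Or.inr rfl)))))

end PocketAtA3

section TwoLeaves
variable {V : Type*} [Fintype V] [DecidableEq V] {R : Type*} [Field R] [LinearOrder R]
  [IsStrictOrderedRing R] {E : Type u} [Fintype E] [DecidableEq E]
variable {ends : E → Sym2 V} {o a₁ a₂ a₃ b y : V} {e₀ e₁ : E}

omit [Fintype V] [DecidableEq V] [Fintype E] [DecidableEq E] in
/-- A leaf stays a leaf after deleting another edge. -/
lemma IsLeafAt.restrict (hl : IsLeafAt ends y b e₁) (hne : e₁ ≠ e₀) :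
    IsLeafAt (restrictEnds ends e₀) y b ⟨e₁, hne⟩ where
  ends_eq := hl.ends_eq
  unique := fun e he => Subtype.ext (hl.unique e.1 he)
  ne := hl.ne

/-- **The marks `o` and `b` both pendant at a common vertex `y` close every statement vertex**
(`o, b ∉ {a₁, a₂, a₃}`, `o ≠ b`): both move onto `y` and coincide there. -/
theorem closedAt_of_o_b_leaves (hlo : IsLeafAt ends y o e₀) (hlb : IsLeafAt ends y b e₁)
    (hob : o ≠ b) (h1o : a₁ ≠ o) (h2o : a₂ ≠ o) (h3o : a₃ ≠ o) (h1b : a₁ ≠ b) (h2b : a₂ ≠ b)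
    (h3b : a₃ ≠ b) : ClosedAt R o a₁ a₂ b E ends a₃ := by
  have hne : e₁ ≠ e₀ := by
    intro h
    have := hlb.ends_eq
    rw [h, hlo.ends_eq, Sym2.eq_iff] at this
    rcases this with ⟨_, h'⟩ | ⟨h', _⟩
    · exact hob h'
    · exact hlb.ne h'
  refine closedAt_of_o_move hlo h1o h2o h3o hob.symm ?_
  refine closedAt_of_b_move (hlb.restrict hne) hlb.ne h1b h2b h3b ?_
  exact closedAt_of_o_eq_b a₁ a₂ a₃ y

end TwoLeaves

end CaseOne

end Summit.Ventures.PercRepro2
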